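import Summits.Ventures.QEC.Thresholds.ToricCodeXSectorPhenomenologicalDual
import Literature.InformationTheory.QuantumCodes.CSSPhenomenologicalDepolarizing
import HarnessLib

/-!
# The toric code under PHENOMENOLOGICAL DEPOLARIZING noise (qubits depolarized at rate `p` per round, star AND plaquette
# records wrong at rates `q_X`, `q_Z`), sector-wise minimum-weight space-time decoding: certified region
# `p < (3/2)·p₀(4.7476)`, `q_X, q_Z < p₀(4.7476)` — in decimals `p ≤ .0168`, `q ≤ .0112` — UNCONDITIONAL, kernel

Venture QEC, `Summits/Ventures/QEC/Thresholds/` (LADDER-QEC rung Q5, PARTITION row 09 "noise models: depolarising;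
phenomenological"; qec-type-09 gen 5, item 09.PHDEPOL). Packaging of `CSSPhenomenologicalDepolarizing.lean` (the three-rate
law `depolPhenomWeight`, sector-wise space-time decoding, the sandwich `max(P^Z, P^X) ≤ P_fail ≤ P^Z + P^X` with
`P^Z = P^{Z,ph}(2p/3, q_X)`, `P^X = P^{X,ph}(2p/3, q_Z)`) for the lattice toric codes `toricCode (L+1)`, using the two
certified two-rate BOXES `p₀(4.7476)` of the tree: `Z` sector `phenom_isThresholdBoxLowerBound_kernelZ3SymmK12`
(`ToricCodeMWPMThresholdsSymmK16.lean`, the DKLP space-time polygon route on qec-type-03's `μ(ℤ³) ≤ 4.7476`) and `X` sector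
`toric_x_phenom_isThresholdBoxLowerBound_kernelZ3SymmK12` (`ToricCodeXSectorPhenomenologicalDual.lean`, space-time duality).

| theorem | statement |
|---|---|
| `toric_depolPhenom_belowThreshold_kernelZ3SymmK12` | every poly `T`, every pair of min-weight space-time decoder families (star record, plaquette record): `0 ≤ p < (3/2)·p₀(4.7476)`, `0 ≤ q_X, q_Z < p₀(4.7476)` ⇒ `P_fail → 0` |
| `toric_depolPhenom_belowThreshold_0168_0112` | decimals: **`p ≤ .0168`, `q_X, q_Z ≤ .0112`** ⇒ `P_fail → 0` |
| `toric_depolPhenom_isThresholdLowerBound_diag`, `toric_depolPhenom_accuracyThreshold_diag_gt_0112` | the one-parameter diagonal `q_X = q_Z = p`: threshold `≥ p₀(4.7476)`, **`p_c > .0112`** (the measurement rate binds) |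
| `toric_depolPhenom_isThresholdLowerBound_fixedQ`, `toric_depolPhenom_accuracyThreshold_fixedQ_gt_0168` | fixed measurement rates `q_X, q_Z ≤ .0112`: threshold in the depolarizing rate `≥ (3/2)·p₀(4.7476)`, **`> .0168`** |
| `toric_quarter_le_depolPhenomFailureProb`, `toric_depolPhenom_threshold_fixedQ_le` | CEILING: `1/4 ≤ P_fail(3/8, q_X, q_Z)` for EVERY pair of space-time decoders, every `T ≥ 1`, all `q_X, q_Z ∈ [0,1]` ⇒ along every line of fixed measurement rates the depolarizing-rate threshold is `≤ 3/8` |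

All UNCONDITIONAL, tier CERTIFIED (kernel), axioms standard, 0 named facts; the floors are certified LOWER bounds on the
threshold region for SECTOR-WISE (correlation-blind) minimum-weight space-time decoding; `3/2` is the marginal factor
`P(X-part flips) = 2p/3`; circuit-level noise is not this model. Theorem-only file.

## References

* [DennisEtAl2002] E. Dennis, A. Kitaev, A. Landahl, J. Preskill, *Topological quantum memory*, J. Math. Phys. 43 (2002)
  4452–4505, arXiv:quant-ph/0110143, §4.1 (chunk p0012 L5–18: DKLP's own qubit channel is the INDEPENDENT X/Z model at
  rate p; q = probability that a measured syndrome bit is faulty (L18); separate recovery procedures for X and Z errors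
  (L16)), §4.2 (the error history), §5.3 eqs. (threshold_iso), (threshold_iso_num).
* [AliferisGottesmanPreskill2006] P. Aliferis, D. Gottesman, J. Preskill, QIC 6 (2006) 97, arXiv:quant-ph/0504218, §8.2
  (chunk p0026 L11: depolarizing faults = a Pauli operator chosen equiprobably from {X, Y, Z} — the p/3 convention of the
  tree's `depolarizingLaw`; the three-rate model itself is the tree's, `CSSPhenomenologicalDepolarizing.lean`).
* [PonitzTittmann2000] A. Pönitz, P. Tittmann, Electron. J. Combin. 7 (2000) R21, Table 2 (`d = 3, k = 12`: `4.7476`).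
* [RichardsonUrbanke2008] T. Richardson, R. Urbanke, *Modern Coding Theory*, Lemma 4.78 (erasure decomposition; the ceiling).
-/

noncomputable section

namespace Summit.Ventures.QEC.Thresholds

open Filter Topology Finset Matrix
open Literature.InformationTheory.QuantumCodes
open Literature.InformationTheory.QuantumCodes.ToricCode
open Literature.Probability.RandomPlanarGeometry

/-! ### The certified region -/

/-- **Toric code, phenomenological depolarizing noise, sector-wise minimum-weight space-time decoding: certified region
`p < (3/2)·p₀(4.7476)`, `q_X, q_Z < p₀(4.7476)`** — for every polynomially bounded schedule `T`, every minimum-weight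
space-time decoder family `DZ` of the star record and `DX` of the plaquette record, the failure probability of the
`(L+1) × (L+1)` memory experiment tends to `0`. UNCONDITIONAL, kernel (`μ(ℤ³) ≤ 4.7476`).
[cite: DennisEtAl2002, §5.3 eq. (threshold_iso) (region shape) with §4.1 (chunk p0012 L16, paraphrase: separate recovery of X and Z errors)]
[cite: AliferisGottesmanPreskill2006, §8.2 (chunk p0026 L11: the depolarizing channel, X, Y, Z equiprobable)] -/
theorem toric_depolPhenom_belowThreshold_kernelZ3SymmK12 {T : ℕ → ℕ} (hT : IsPolyBounded T)
    (DZ : (L : ℕ) → STDecoder (L + 1) (T L))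
    (hDZ : ∀ L, (DZ L).IsMinWeight (stSyn (L + 1) (T L)) (stCycles (L + 1) (T L)) hammingNorm)
    (DX : ∀ L, CSSPhenom.STDecoder (Vertex (L + 1)) (Edge (L + 1)) (T L))
    (hDX : ∀ L, (DX L).IsMinWeight (CSSPhenom.stSyn (toricCode (L + 1)).HZ (T L))
      (CSSPhenom.stCycles (toricCode (L + 1)).HZ (T L)) hammingNorm)
    {p qX qZ : ℝ} (hp0 : 0 ≤ p) (hp : p < 3 / 2 * thresholdValue 4.7476) (hqX0 : 0 ≤ qX)
    (hqX : qX < thresholdValue 4.7476) (hqZ0 : 0 ≤ qZ) (hqZ : qZ < thresholdValue 4.7476) :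
    Tendsto (fun L => (toricCode (L + 1)).depolPhenomFailureProb (T L) (DZ L) (DX L) p qX qZ) atTop (𝓝 0) := by
  have hv : thresholdValue (4.7476 : ℝ) ≤ 1 / 2 := thresholdValue_le_half _
  exact CSSCode.depolPhenom_belowThreshold_of_box (fun L => toricCode (L + 1)) T DZ DX
    (phenom_isThresholdBoxLowerBound_kernelZ3SymmK12 hT hDZ)
    (toric_x_phenom_isThresholdBoxLowerBound_kernelZ3SymmK12 hT DX hDX)
    hp0 (by linarith) hp hqX0 (by linarith) hqX hqZ0 (by linarith) hqZ

/-- **Decimal form: `0 ≤ p ≤ .0168`, `0 ≤ q_X, q_Z ≤ .0112` ⇒ `P_fail → 0`** (toric code, phenomenological depolarizing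
noise, sector-wise minimum-weight space-time decoding, poly `T`) — UNCONDITIONAL, kernel.
[cite: DennisEtAl2002, §5.3 eq. (threshold_iso_num) (the decimal box shape)] [cite: AliferisGottesmanPreskill2006, §8.2 (chunk p0026 L11)] -/
theorem toric_depolPhenom_belowThreshold_0168_0112 {T : ℕ → ℕ} (hT : IsPolyBounded T)
    (DZ : (L : ℕ) → STDecoder (L + 1) (T L))
    (hDZ : ∀ L, (DZ L).IsMinWeight (stSyn (L + 1) (T L)) (stCycles (L + 1) (T L)) hammingNorm)
    (DX : ∀ L, CSSPhenom.STDecoder (Vertex (L + 1)) (Edge (L + 1)) (T L))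
    (hDX : ∀ L, (DX L).IsMinWeight (CSSPhenom.stSyn (toricCode (L + 1)).HZ (T L))
      (CSSPhenom.stCycles (toricCode (L + 1)).HZ (T L)) hammingNorm)
    {p qX qZ : ℝ} (hp0 : 0 ≤ p) (hp : p ≤ 0.0168) (hqX0 : 0 ≤ qX) (hqX : qX ≤ 0.0112) (hqZ0 : 0 ≤ qZ)
    (hqZ : qZ ≤ 0.0112) :
    Tendsto (fun L => (toricCode (L + 1)).depolPhenomFailureProb (T L) (DZ L) (DX L) p qX qZ) atTop (𝓝 0) := by
  have h := thresholdValue_47476_bounds.1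
  exact toric_depolPhenom_belowThreshold_kernelZ3SymmK12 hT DZ hDZ DX hDX hp0 (by linarith) hqX0 (by linarith)
    hqZ0 (by linarith)

/-! ### One-parameter slices -/

/-- **The diagonal `q_X = q_Z = p`: threshold `≥ p₀(4.7476)`** (the measurement rate is the binding constraint) — every poly
`T`, every pair of minimum-weight space-time decoder families. UNCONDITIONAL, kernel.
[cite: DennisEtAl2002, §5.3 ("Eq. (threshold_iso_num) bounds the accuracy threshold in the case p = q")] -/
theorem toric_depolPhenom_isThresholdLowerBound_diag {T : ℕ → ℕ} (hT : IsPolyBounded T)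
    (DZ : (L : ℕ) → STDecoder (L + 1) (T L))
    (hDZ : ∀ L, (DZ L).IsMinWeight (stSyn (L + 1) (T L)) (stCycles (L + 1) (T L)) hammingNorm)
    (DX : ∀ L, CSSPhenom.STDecoder (Vertex (L + 1)) (Edge (L + 1)) (T L))
    (hDX : ∀ L, (DX L).IsMinWeight (CSSPhenom.stSyn (toricCode (L + 1)).HZ (T L))
      (CSSPhenom.stCycles (toricCode (L + 1)).HZ (T L)) hammingNorm) :
    IsThresholdLowerBound (fun L p => (toricCode (L + 1)).depolPhenomFailureProb (T L) (DZ L) (DX L) p p p)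
      (thresholdValue 4.7476) := by
  intro p hp0 hp
  have hv : 0 ≤ thresholdValue (4.7476 : ℝ) := thresholdValue_nonneg _
  exact toric_depolPhenom_belowThreshold_kernelZ3SymmK12 hT DZ hDZ DX hDX hp0 (by linarith) hp0 hp hp0 hp

/-- **`p_c > .0112` on the diagonal `q_X = q_Z = p`** (decimal, kernel). [cite: DennisEtAl2002, §5.3 eq. (threshold_iso_num)] -/
theorem toric_depolPhenom_accuracyThreshold_diag_gt_0112 {T : ℕ → ℕ} (hT : IsPolyBounded T)
    (DZ : (L : ℕ) → STDecoder (L + 1) (T L))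
    (hDZ : ∀ L, (DZ L).IsMinWeight (stSyn (L + 1) (T L)) (stCycles (L + 1) (T L)) hammingNorm)
    (DX : ∀ L, CSSPhenom.STDecoder (Vertex (L + 1)) (Edge (L + 1)) (T L))
    (hDX : ∀ L, (DX L).IsMinWeight (CSSPhenom.stSyn (toricCode (L + 1)).HZ (T L))
      (CSSPhenom.stCycles (toricCode (L + 1)).HZ (T L)) hammingNorm) :
    (0.0112 : ℝ) < accuracyThreshold
      (fun L p => (toricCode (L + 1)).depolPhenomFailureProb (T L) (DZ L) (DX L) p p p) :=
  lt_of_lt_of_le thresholdValue_47476_bounds.1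
    (le_accuracyThreshold (toric_depolPhenom_isThresholdLowerBound_diag hT DZ hDZ DX hDX)
      ((thresholdValue_le_half _).trans (by norm_num)))

/-- **Fixed measurement rates `0 ≤ q_X, q_Z ≤ .0112`: threshold in the depolarizing rate `≥ (3/2)·p₀(4.7476)`** — every
poly `T`, every pair of minimum-weight space-time decoder families. UNCONDITIONAL, kernel.
The `3/2` is the tree's marginal factor (`sum_depolarizingProb_zBit_mem`: the phase-flip part of a `p/3`-per-Pauli fault flips at
rate `2p/3`). [cite: AliferisGottesmanPreskill2006, §8.2 (chunk p0026 L11)] [cite: DennisEtAl2002, §5.3 eq. (threshold_iso)] -/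
theorem toric_depolPhenom_isThresholdLowerBound_fixedQ {T : ℕ → ℕ} (hT : IsPolyBounded T)
    (DZ : (L : ℕ) → STDecoder (L + 1) (T L))
    (hDZ : ∀ L, (DZ L).IsMinWeight (stSyn (L + 1) (T L)) (stCycles (L + 1) (T L)) hammingNorm)
    (DX : ∀ L, CSSPhenom.STDecoder (Vertex (L + 1)) (Edge (L + 1)) (T L))
    (hDX : ∀ L, (DX L).IsMinWeight (CSSPhenom.stSyn (toricCode (L + 1)).HZ (T L))
      (CSSPhenom.stCycles (toricCode (L + 1)).HZ (T L)) hammingNorm)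
    {qX qZ : ℝ} (hqX0 : 0 ≤ qX) (hqX : qX ≤ 0.0112) (hqZ0 : 0 ≤ qZ) (hqZ : qZ ≤ 0.0112) :
    IsThresholdLowerBound (fun L p => (toricCode (L + 1)).depolPhenomFailureProb (T L) (DZ L) (DX L) p qX qZ)
      (3 / 2 * thresholdValue 4.7476) := by
  intro p hp0 hp
  have h := thresholdValue_47476_bounds.1
  exact toric_depolPhenom_belowThreshold_kernelZ3SymmK12 hT DZ hDZ DX hDX hp0 hp hqX0 (by linarith) hqZ0
    (by linarith)

/-- **`p_c^{depol} > .0168` at fixed measurement rates `q_X, q_Z ≤ .0112`** (decimal, kernel).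
[cite: DennisEtAl2002, §5.3 eq. (threshold_iso_num)] [cite: AliferisGottesmanPreskill2006, §8.2 (chunk p0026 L11)] -/
theorem toric_depolPhenom_accuracyThreshold_fixedQ_gt_0168 {T : ℕ → ℕ} (hT : IsPolyBounded T)
    (DZ : (L : ℕ) → STDecoder (L + 1) (T L))
    (hDZ : ∀ L, (DZ L).IsMinWeight (stSyn (L + 1) (T L)) (stCycles (L + 1) (T L)) hammingNorm)
    (DX : ∀ L, CSSPhenom.STDecoder (Vertex (L + 1)) (Edge (L + 1)) (T L))
    (hDX : ∀ L, (DX L).IsMinWeight (CSSPhenom.stSyn (toricCode (L + 1)).HZ (T L))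
      (CSSPhenom.stCycles (toricCode (L + 1)).HZ (T L)) hammingNorm)
    {qX qZ : ℝ} (hqX0 : 0 ≤ qX) (hqX : qX ≤ 0.0112) (hqZ0 : 0 ≤ qZ) (hqZ : qZ ≤ 0.0112) :
    (0.0168 : ℝ) < accuracyThreshold
      (fun L p => (toricCode (L + 1)).depolPhenomFailureProb (T L) (DZ L) (DX L) p qX qZ) := by
  have h := thresholdValue_47476_bounds.1
  have hv : thresholdValue (4.7476 : ℝ) ≤ 1 / 2 := thresholdValue_le_half _
  exact lt_of_lt_of_le (by linarith)
    (le_accuracyThreshold (toric_depolPhenom_isThresholdLowerBound_fixedQ hT DZ hDZ DX hDX hqX0 hqX hqZ0 hqZ)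
      (by linarith))

/-- Canonical instance (`T(L) = L + 1` rounds, canonical minimum-weight space-time decoders of both records):
`p ≤ .0168`, `q_X, q_Z ≤ .0112` ⇒ `P_fail → 0`. [cite: DennisEtAl2002, §5.1 eq. (E_min)] -/
theorem toric_depolPhenom_belowThreshold_stMinWeight_0168_0112 {p qX qZ : ℝ} (hp0 : 0 ≤ p) (hp : p ≤ 0.0168)
    (hqX0 : 0 ≤ qX) (hqX : qX ≤ 0.0112) (hqZ0 : 0 ≤ qZ) (hqZ : qZ ≤ 0.0112) :
    Tendsto (fun L => (toricCode (L + 1)).depolPhenomFailureProb (L + 1)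
      (Decoder.minWeight (stSyn (L + 1) (L + 1)) hammingNorm)
      (Decoder.minWeight (CSSPhenom.stSyn (toricCode (L + 1)).HZ (L + 1)) hammingNorm) p qX qZ) atTop (𝓝 0) :=
  toric_depolPhenom_belowThreshold_0168_0112 isPolyBounded_succ _
    (fun L => ToricCode.isMinWeight_stMinWeight (L + 1) (L + 1)) _ (fun _ => CSSPhenom.isMinWeight_minWeight _ _)
    hp0 hp hqX0 hqX hqZ0 hqZ

/-! ### The ceiling `3/8` in the depolarizing rate -/

/-- **`1/4 ≤ P_fail(3/8, q_X, q_Z)` for EVERY pair of space-time decoders**, every `T ≥ 1`, all measurement rates in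
`[0, 1]`: at depolarizing rate `3/8` the phase-flip marginal is `1/4`, where qec-lit-2's genie bound forces the `Z`-sector
decoder of the erasure-symmetric toric code to fail with probability `≥ 1/4`. UNCONDITIONAL, kernel.
[cite: RichardsonUrbanke2008, Lemma 4.78] [cite: DennisEtAl2002, §4.6 (p_c)] -/
theorem toric_quarter_le_depolPhenomFailureProb (L T : ℕ) [NeZero L] (DZ : STDecoder L T)
    (DX : CSSPhenom.STDecoder (Vertex L) (Edge L) T) (t₀ : Fin T) {qX qZ : ℝ} (hqX0 : 0 ≤ qX) (hqX1 : qX ≤ 1)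
    (hqZ0 : 0 ≤ qZ) (hqZ1 : qZ ≤ 1) :
    1 / 4 ≤ (toricCode L).depolPhenomFailureProb T DZ DX (3 / 8) qX qZ := by
  have h1 := (toricCode L).quarter_le_zPhenom_quarter_aniso_of_symm toricCode_k_pos
    (fun y => ToricCode.uncorrectableProb_dual y) DZ t₀ hqX0 hqX1
  have h2 := (toricCode L).zPhenom_le_depolPhenomFailureProb T DZ DX (p := 3 / 8) (by norm_num) (by norm_num)
    hqX0 hqX1 hqZ0 hqZ1
  rw [show (2 : ℝ) * (3 / 8) / 3 = 1 / 4 by norm_num] at h2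
  exact h1.trans h2

/-- **Ceiling**: along every line of fixed measurement rates `q_X(L), q_Z(L) ∈ [0, 1]` (schedule `T_L ≥ 1`), a certified
lower bound `a` on the depolarizing-rate threshold of ANY pair of space-time decoder families satisfies `a ≤ 3/8`.
[cite: RichardsonUrbanke2008, Lemma 4.78] [cite: DennisEtAl2002, §4.6 (p_c)] -/
theorem toric_depolPhenom_threshold_fixedQ_le {T : ℕ → ℕ} (hT : ∀ L, 0 < T L)
    (DZ : (L : ℕ) → STDecoder (L + 1) (T L)) (DX : ∀ L, CSSPhenom.STDecoder (Vertex (L + 1)) (Edge (L + 1)) (T L))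
    (qX qZ : ℕ → ℝ) (hqX0 : ∀ L, 0 ≤ qX L) (hqX1 : ∀ L, qX L ≤ 1) (hqZ0 : ∀ L, 0 ≤ qZ L) (hqZ1 : ∀ L, qZ L ≤ 1)
    {a : ℝ}
    (ha : IsThresholdLowerBound
      (fun L p => (toricCode (L + 1)).depolPhenomFailureProb (T L) (DZ L) (DX L) p (qX L) (qZ L)) a) :
    a ≤ 3 / 8 := by
  by_contra h
  push Not at h
  have hlim := ha (3 / 8) (by norm_num) h
  have hge : ∀ L, (1 : ℝ) / 4 ≤
      (toricCode (L + 1)).depolPhenomFailureProb (T L) (DZ L) (DX L) (3 / 8) (qX L) (qZ L) := fun L =>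
    toric_quarter_le_depolPhenomFailureProb (L + 1) (T L) (DZ L) (DX L) ⟨0, hT L⟩ (hqX0 L) (hqX1 L) (hqZ0 L)
      (hqZ1 L)
  have := le_of_tendsto_of_tendsto' tendsto_const_nhds hlim hge
  norm_num at this

/-- **Certified interval on every line `q_X, q_Z ≤ .0112`**: `.0168 < p_c^{depol} ≤ 3/8` (floor: sector-wise minimum-weight
space-time decoding, poly `T_L ≥ 1`; ceiling: every pair of space-time decoder families).
[cite: DennisEtAl2002, §4.6 and §5.3 eq. (threshold_iso_num); RichardsonUrbanke2008, Lemma 4.78] -/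
theorem toric_depolPhenom_accuracyThreshold_fixedQ_mem {T : ℕ → ℕ} (hT : IsPolyBounded T) (hT1 : ∀ L, 0 < T L)
    (DZ : (L : ℕ) → STDecoder (L + 1) (T L))
    (hDZ : ∀ L, (DZ L).IsMinWeight (stSyn (L + 1) (T L)) (stCycles (L + 1) (T L)) hammingNorm)
    (DX : ∀ L, CSSPhenom.STDecoder (Vertex (L + 1)) (Edge (L + 1)) (T L))
    (hDX : ∀ L, (DX L).IsMinWeight (CSSPhenom.stSyn (toricCode (L + 1)).HZ (T L))
      (CSSPhenom.stCycles (toricCode (L + 1)).HZ (T L)) hammingNorm)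
    {qX qZ : ℝ} (hqX0 : 0 ≤ qX) (hqX : qX ≤ 0.0112) (hqZ0 : 0 ≤ qZ) (hqZ : qZ ≤ 0.0112) :
    (0.0168 : ℝ) < accuracyThreshold
        (fun L p => (toricCode (L + 1)).depolPhenomFailureProb (T L) (DZ L) (DX L) p qX qZ) ∧
      accuracyThreshold (fun L p => (toricCode (L + 1)).depolPhenomFailureProb (T L) (DZ L) (DX L) p qX qZ) ≤
        3 / 8 :=
  ⟨toric_depolPhenom_accuracyThreshold_fixedQ_gt_0168 hT DZ hDZ DX hDX hqX0 hqX hqZ0 hqZ,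
    toric_depolPhenom_threshold_fixedQ_le hT1 DZ DX (fun _ => qX) (fun _ => qZ) (fun _ => hqX0)
      (fun _ => by linarith) (fun _ => hqZ0) (fun _ => by linarith) (isThresholdLowerBound_accuracyThreshold _)⟩

/-! ### The diagonal ceiling (appended, qec-type-09 gen 5) -/

/-- **`1/4 ≤ P_fail(3/8, 3/8, 3/8)`** on the diagonal, EVERY pair of space-time decoders, every `T ≥ 1` (the fixed-`q` genie bound at
`q_X = q_Z = 3/8`). UNCONDITIONAL, kernel. [cite: RichardsonUrbanke2008, Lemma 4.78] [cite: DennisEtAl2002, §4.6 (p_c)] -/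
theorem toric_quarter_le_depolPhenomFailureProb_diag (L T : ℕ) [NeZero L] (DZ : STDecoder L T)
    (DX : CSSPhenom.STDecoder (Vertex L) (Edge L) T) (t₀ : Fin T) :
    1 / 4 ≤ (toricCode L).depolPhenomFailureProb T DZ DX (3 / 8) (3 / 8) (3 / 8) :=
  toric_quarter_le_depolPhenomFailureProb L T DZ DX t₀ (by norm_num) (by norm_num) (by norm_num) (by norm_num)

/-- **Diagonal ceiling**: on the diagonal `q_X = q_Z = p` (schedule `T_L ≥ 1`), every certified lower bound `a` on the threshold of ANY pair
of space-time decoder families satisfies `a ≤ 3/8`. [cite: RichardsonUrbanke2008, Lemma 4.78] [cite: DennisEtAl2002, §4.6 (p_c)] -/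
theorem toric_depolPhenom_threshold_diag_le {T : ℕ → ℕ} (hT : ∀ L, 0 < T L)
    (DZ : (L : ℕ) → STDecoder (L + 1) (T L)) (DX : ∀ L, CSSPhenom.STDecoder (Vertex (L + 1)) (Edge (L + 1)) (T L)) {a : ℝ}
    (ha : IsThresholdLowerBound (fun L p => (toricCode (L + 1)).depolPhenomFailureProb (T L) (DZ L) (DX L) p p p) a) :
    a ≤ 3 / 8 := by
  by_contra h
  push Not at h
  have hlim := ha (3 / 8) (by norm_num) h
  have hge : ∀ L, (1 : ℝ) / 4 ≤ (toricCode (L + 1)).depolPhenomFailureProb (T L) (DZ L) (DX L) (3 / 8) (3 / 8) (3 / 8) :=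
    fun L => toric_quarter_le_depolPhenomFailureProb_diag (L + 1) (T L) (DZ L) (DX L) ⟨0, hT L⟩
  have := le_of_tendsto_of_tendsto' tendsto_const_nhds hlim hge
  norm_num at this

/-- **Certified diagonal interval `.0112 < p_c^{diag} ≤ 3/8`** (`q_X = q_Z = p`; floor: sector-wise minimum-weight space-time decoding, poly
`T_L ≥ 1`; ceiling: every pair of space-time decoder families). [cite: DennisEtAl2002, §5.3 eq. (threshold_iso_num) and §4.6; RichardsonUrbanke2008, Lemma 4.78] -/
theorem toric_depolPhenom_accuracyThreshold_diag_mem {T : ℕ → ℕ} (hT : IsPolyBounded T) (hT1 : ∀ L, 0 < T L)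
    (DZ : (L : ℕ) → STDecoder (L + 1) (T L))
    (hDZ : ∀ L, (DZ L).IsMinWeight (stSyn (L + 1) (T L)) (stCycles (L + 1) (T L)) hammingNorm)
    (DX : ∀ L, CSSPhenom.STDecoder (Vertex (L + 1)) (Edge (L + 1)) (T L))
    (hDX : ∀ L, (DX L).IsMinWeight (CSSPhenom.stSyn (toricCode (L + 1)).HZ (T L))
      (CSSPhenom.stCycles (toricCode (L + 1)).HZ (T L)) hammingNorm) :
    (0.0112 : ℝ) < accuracyThreshold (fun L p => (toricCode (L + 1)).depolPhenomFailureProb (T L) (DZ L) (DX L) p p p) ∧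
      accuracyThreshold (fun L p => (toricCode (L + 1)).depolPhenomFailureProb (T L) (DZ L) (DX L) p p p) ≤ 3 / 8 :=
  ⟨toric_depolPhenom_accuracyThreshold_diag_gt_0112 hT DZ hDZ DX hDX,
    toric_depolPhenom_threshold_diag_le hT1 DZ DX (isThresholdLowerBound_accuracyThreshold _)⟩

end Summit.Ventures.QEC.Thresholds

end
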